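import Summits.CriticalPhenomena.PercolationContinuityZ3.Theorems.PercNearOneGluingNoHeavyLowerTailKnQuestion8AntitheticInsertion
import HarnessLib

/-!
# `NoHeavyLowerTail` (crux stmt-CriticalPhenomena-4575), antithetic vdBHK programme: THEOREM GI — GENERAL ATOM INSERTION preserves antipodal Kleitman
# (kernel form at the colouring level, conditional on AK of the antidiagonal product)

Support file (seat `prim-ineq-gen-7` gen 56; `--supports stmt-CriticalPhenomena-4575`).  No `sorry`, no definitions.  Memo:
run/shared/lean/prim/prim-ineq-gen-7/FINDING-TWIN-g56.md §5 (THEOREM GI).  Companion of `AntitheticInsertion` (g55), whose two dictionary lemmas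
`diag_iff_ins` / `off_iff_ins` are used verbatim — they were stated for an arbitrary 'dead' set, i.e. for an ARBITRARY up-set `V = ↑°z` above the new element.

SETTING (hypothesis style of `AntitheticHat` / `AntitheticInsertion`).  `E` the ground set of a finite poset `Q` with strict down-sets `down`, `u` an atom,
`dead e` the elements of the up-set `V ⊆ ↑°u` (`hdu`), `z = none` the inserted element with `↓°z = {u}` (`hdZn`) and lying below exactly the dead elements
(`hdZs`); `leT`, `leZ` the explicit three-condition colouring orders of `Q` and `Q + z`; `leN` the ANTIDIAGONAL order on colourings of `Q` ('live conditions +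
dead elements only turn blue → red', i.e. `Ω_{Q∖V} × (blue<red)^V`); `ι′ s = ¬s`, `κ t = ¬t` the colour swaps.  Antipodal Kleitman in the functional form of
`AntitheticStalkSplit`: `0 ≤ #(A ∩ B) − #{s ∈ A : ι′ s ∈ B}` for up-sets `A, B`.
* `AntitheticInsertionAK.insertion_ak` — **THEOREM GI (conditional kernel form)**: if `Ω_Q` is AK (`hAKT`, all pairs of `leT`-up-sets) and the antidiagonal
  product order is AK (`hAKN`, all pairs of `leN`-up-sets), then `Ω_{Q+z}` is AK (all pairs of `leZ`-up-sets).  PROOF = the piece principle made formal: the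
  functional splits over the `κ`-stable diagonal `D = {z ≡ u}` (`AntitheticStalkSplit.R_split`); the diagonal is the image of `δ : s ↦ (z := s u, s)` on which
  `leZ` pulls back to `leT` (`diag_iff_ins`), the antidiagonal the image of `δ′ : s ↦ (z := ¬s u, s)` on which `leZ` pulls back to `leN` (`off_iff_ins`); both
  intertwine the colour swaps, so each part is a pulled-back functional (`R_diag_eq`) of up-sets, `≥ 0` by `hAKT` resp. `hAKN`.
  The remaining input AK(`leN`) is AK of `Ω_{Q∖V} × (blue<red)^V`: descent (`AntitheticDescent`) + the product theorem + Kleitman (memo §5).  Special cases: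
  `V = ∅` the hat (HD of g45), `V = ↑Y` with `Y ⊆ Cov(u)` the root insertion S2ᵤ (g55), `V = ↑°u` the stalk (g54).  Reach of the theorem class with GI:
  β-acyclic 7-posets 1,512 → 1,814 of 2,032 (memo §5).
-/

namespace Summit.CriticalPhenomena.PercolationContinuityZ3.Theorems

open Finset

namespace AntitheticInsertionAK

variable {E : Type*}

/-- **THEOREM GI — general atom insertion preserves antipodal Kleitman (conditional kernel form).**  See the module docstring. [this work] -/
theorem insertion_ak [Fintype E] [DecidableEq E] (down : E → Finset E) (u : E) (hu : ∀ d, d ∉ down u) (dead : E → Prop)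
    (hdu : ∀ e, dead e → u ∈ down e)
    (downZ : Option E → Finset (Option E)) (hdZn : ∀ o, o ∈ downZ none ↔ o = some u)
    (hdZs : ∀ e o, o ∈ downZ (some e) ↔ (∃ d ∈ down e, o = some d) ∨ (o = none ∧ dead e))
    (leT : (E → Bool) → (E → Bool) → Prop)
    (hleT : ∀ s t, leT s t ↔
      ((∀ e, (t e = true ∧ ∀ d ∈ down e, t d = true) → (s e = true ∧ ∀ d ∈ down e, s d = true)) ∧
       (∀ e, (s e = false ∧ ∀ d ∈ down e, s d = false) → (t e = false ∧ ∀ d ∈ down e, t d = false)) ∧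
       (∀ e, s e = true → t e = false → ((∀ d ∈ down e, s d = true) ∧ (∀ d ∈ down e, t d = false)))))
    (leZ : (Option E → Bool) → (Option E → Bool) → Prop)
    (hleZ : ∀ s t, leZ s t ↔
      ((∀ o, (t o = true ∧ ∀ d ∈ downZ o, t d = true) → (s o = true ∧ ∀ d ∈ downZ o, s d = true)) ∧
       (∀ o, (s o = false ∧ ∀ d ∈ downZ o, s d = false) → (t o = false ∧ ∀ d ∈ downZ o, t d = false)) ∧
       (∀ o, s o = true → t o = false → ((∀ d ∈ downZ o, s d = true) ∧ (∀ d ∈ downZ o, t d = false)))))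
    (leN : (E → Bool) → (E → Bool) → Prop)
    (hleN : ∀ s s', leN s s' ↔
      (((∀ e, ¬ dead e → (s' e = true ∧ ∀ d ∈ down e, s' d = true) → (s e = true ∧ ∀ d ∈ down e, s d = true)) ∧
        (∀ e, ¬ dead e → (s e = false ∧ ∀ d ∈ down e, s d = false) → (s' e = false ∧ ∀ d ∈ down e, s' d = false)) ∧
        (∀ e, ¬ dead e → s e = true → s' e = false → ((∀ d ∈ down e, s d = true) ∧ (∀ d ∈ down e, s' d = false)))) ∧
       (∀ e, dead e → s e = true → s' e = true)))
    (ι' : (E → Bool) → (E → Bool)) (hι : ∀ s e, ι' s e = !(s e))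
    (κ : (Option E → Bool) → (Option E → Bool)) (hκ : ∀ t o, κ t o = !(t o))
    (hAKT : ∀ A B : Finset (E → Bool), (∀ s s', leT s s' → s ∈ A → s' ∈ A) → (∀ s s', leT s s' → s ∈ B → s' ∈ B) →
      0 ≤ ((A ∩ B).card : ℤ) - ((A.filter (fun s => ι' s ∈ B)).card : ℤ))
    (hAKN : ∀ A B : Finset (E → Bool), (∀ s s', leN s s' → s ∈ A → s' ∈ A) → (∀ s s', leN s s' → s ∈ B → s' ∈ B) →
      0 ≤ ((A ∩ B).card : ℤ) - ((A.filter (fun s => ι' s ∈ B)).card : ℤ))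
    (AA BB : Finset (Option E → Bool)) (hAA : ∀ t t', leZ t t' → t ∈ AA → t' ∈ AA) (hBB : ∀ t t', leZ t t' → t ∈ BB → t' ∈ BB) :
    0 ≤ ((AA ∩ BB).card : ℤ) - ((AA.filter (fun z => κ z ∈ BB)).card : ℤ) := by
  classical
  -- the two embeddings `δ` (diagonal: `z` coloured like `u`) and `δ'` (antidiagonal) and the diagonal `D`
  set δ : (E → Bool) → (Option E → Bool) := fun s o => Option.elim o (s u) s
  set δ' : (E → Bool) → (Option E → Bool) := fun s o => Option.elim o (!(s u)) s
  set D : Finset (Option E → Bool) := Finset.univ.filter (fun t => t none = t (some u))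
  have δsome : ∀ s e, δ s (some e) = s e := fun s e => rfl
  have δnone : ∀ s, δ s none = s u := fun s => rfl
  have δ'some : ∀ s e, δ' s (some e) = s e := fun s e => rfl
  have δ'none : ∀ s, δ' s none = !(s u) := fun s => rfl
  have hDmem : ∀ t, t ∈ D ↔ t none = t (some u) := fun t => by simp [D]
  have hDcmem : ∀ t, t ∈ univ \ D ↔ t none = !(t (some u)) := by
    intro t; rw [Finset.mem_sdiff, hDmem]; simp only [Finset.mem_univ, true_and]
    cases t none <;> cases t (some u) <;> decide
  have hδ : Function.Injective δ := by
    intro s s' h; funext e; have h1 := congrFun h (some e); rwa [δsome, δsome] at h1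
  have hδ' : Function.Injective δ' := by
    intro s s' h; funext e; have h1 := congrFun h (some e); rwa [δ'some, δ'some] at h1
  have hκδ : ∀ s, κ (δ s) = δ (ι' s) := by
    intro s; funext o
    cases o with
    | none => show κ (δ s) none = ι' s u; rw [hκ, hι, δnone]
    | some e => show κ (δ s) (some e) = ι' s e; rw [hκ, hι, δsome]
  have hκδ' : ∀ s, κ (δ' s) = δ' (ι' s) := by
    intro s; funext o
    cases o with
    | none => show κ (δ' s) none = !(ι' s u); rw [hκ, hι, δ'none]
    | some e => show κ (δ' s) (some e) = ι' s e; rw [hκ, hι, δ'some]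
  have hD : ∀ t, t ∈ D ↔ κ t ∈ D := by
    intro t; rw [hDmem, hDmem, hκ, hκ]
    constructor
    · intro h; rw [h]
    · intro h; exact Bool.not_inj h
  have hDδ : ∀ s, δ s ∈ D := fun s => by rw [hDmem, δnone, δsome]
  have hDsurj : ∀ t ∈ D, ∃ s, δ s = t := by
    intro t ht; refine ⟨fun e => t (some e), ?_⟩; funext o
    cases o with
    | none => show t (some u) = t none; exact ((hDmem t).1 ht).symm
    | some e => rfl
  have hD'δ' : ∀ s, δ' s ∈ univ \ D := fun s => by rw [hDcmem, δ'none, δ'some]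
  have hD'surj : ∀ t ∈ univ \ D, ∃ s, δ' s = t := by
    intro t ht; refine ⟨fun e => t (some e), ?_⟩; funext o
    cases o with
    | none => show (!(t (some u))) = t none; exact ((hDcmem t).1 ht).symm
    | some e => rfl
  -- the pulled-back sets are up-sets for `leT` resp. `leN`
  have DI := fun s s' => AntitheticInsertion.diag_iff_ins down u hu dead hdu downZ hdZn hdZs leT hleT leZ hleZ s s' (δ s) (δ s')
    (δsome s) (δsome s') (δnone s) (δnone s')
  have OI := fun s s' => AntitheticInsertion.off_iff_ins down u hu dead hdu downZ hdZn hdZs leZ hleZ s s' (δ' s) (δ' s')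
    (δ'some s) (δ'some s') (δ'none s) (δ'none s')
  have upA : ∀ s s', leT s s' → s ∈ univ.filter (fun s => δ s ∈ AA) → s' ∈ univ.filter (fun s => δ s ∈ AA) := by
    intro s s' hss' hs; simp only [Finset.mem_filter, Finset.mem_univ, true_and] at hs ⊢
    exact hAA _ _ ((DI s s').2 hss') hs
  have upB : ∀ s s', leT s s' → s ∈ univ.filter (fun s => δ s ∈ BB) → s' ∈ univ.filter (fun s => δ s ∈ BB) := by
    intro s s' hss' hs; simp only [Finset.mem_filter, Finset.mem_univ, true_and] at hs ⊢
    exact hBB _ _ ((DI s s').2 hss') hs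
  have upA' : ∀ s s', leN s s' → s ∈ univ.filter (fun s => δ' s ∈ AA) → s' ∈ univ.filter (fun s => δ' s ∈ AA) := by
    intro s s' hss' hs; simp only [Finset.mem_filter, Finset.mem_univ, true_and] at hs ⊢
    exact hAA _ _ ((OI s s').2 ((hleN s s').1 hss')) hs
  have upB' : ∀ s s', leN s s' → s ∈ univ.filter (fun s => δ' s ∈ BB) → s' ∈ univ.filter (fun s => δ' s ∈ BB) := by
    intro s s' hss' hs; simp only [Finset.mem_filter, Finset.mem_univ, true_and] at hs ⊢
    exact hBB _ _ ((OI s s').2 ((hleN s s').1 hss')) hs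
  -- assembly: split over `D ⊔ Dᶜ`; each part is a pulled-back functional of up-sets
  have eA : AA \ D = AA ∩ (univ \ D) := by
    ext t; simp only [Finset.mem_sdiff, Finset.mem_inter, Finset.mem_univ, true_and]
  have eB : BB \ D = BB ∩ (univ \ D) := by
    ext t; simp only [Finset.mem_sdiff, Finset.mem_inter, Finset.mem_univ, true_and]
  have hdiag := AntitheticStalkSplit.R_diag_eq δ hδ ι' κ hκδ D hDδ hDsurj AA BB
  have hoff := AntitheticStalkSplit.R_diag_eq δ' hδ' ι' κ hκδ' (univ \ D) hD'δ' hD'surj AA BB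
  have h1 := hAKT _ _ upA upB
  have h2 := hAKN _ _ upA' upB'
  rw [AntitheticStalkSplit.R_split κ D hD AA BB, eA, eB, hdiag, hoff]
  linarith

end AntitheticInsertionAK

end Summit.CriticalPhenomena.PercolationContinuityZ3.Theorems
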